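import Summits.CriticalPhenomena.CardyFormulaZ2.Theorems.CardySelfRefinementRotationInput
import HarnessLib

/-!
# Stub S1 `stub_rotationInvariantLimits` of crux `Z2LimitsSymmetric` — the conditional wiring

Crux `Z2LimitsSymmetric` (stmt-CriticalPhenomena-14827) of route `CardyMeckeFlip`, sub-problem
`CardyFormulaZ2`, line `registered` (`Cruxes/Z2LimitsSymmetric/Lines/birth.lean`), stub S1:
every subsequential quad-crossing scaling limit `μ ∈ Λ = subseqQuadLimits univ` of critical bond
percolation on `δℤ²` is invariant under every rotation `z ↦ e^{iα} z` of the plane,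
`isometryLaw (rotation e^{iα}) μ = μ`.

This is the rotation-invariance theorem of Duminil-Copin–Kozlowski–Krachun–Manolescu–Oulamara
(arXiv:2012.11672, Thm. 1.2) read in the Schramm–Smirnov space; the stub's statement is VERBATIM the
shared item `CardySelfRefinement.RotationInput` (stmt-CriticalPhenomena-10270).  The tree proves the
whole ℋ-space passage (`Theorems/CardySelfRefinementRotationInput.lean`,
`rotationInput_of_dkkmo_theorem_1_2_schrammSmirnov`) and leaves exactly the published theorem as a
named Literature fact, `dkkmo_theorem_1_2_schrammSmirnov`
(`Literature/Probability/Percolation/QuadCrossingRotationCoupling.lean`).  Accordingly this file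
records the stub CONDITIONALLY on that fact: `stub_rotationInvariantLimits_of_dkkmo`.  STATUS:
conditional-result; trust base `{dkkmo_theorem_1_2_schrammSmirnov}` = DKKMO's theorem itself.

## References

* [DKKMO2020Rotational] H. Duminil-Copin, K. K. Kozlowski, D. Krachun, I. Manolescu, M. Oulamara,
  *Rotational invariance in critical planar lattice models*, arXiv:2012.11672, Thm. 1.2, §1.3, §7.1.
* [SchrammSmirnov2011] O. Schramm, S. Smirnov, Ann. Probab. 39 (2011) 1768–1814, §1.3–1.4.
-/

noncomputable section

open MeasureTheory Filter Set Topology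
open Literature.Probability.Percolation Literature.Probability.Percolation.QuadCrossing

namespace Summit.CriticalPhenomena.CardyFormulaZ2.Cruxes.Z2LimitsSymmetric

/-- **S1, conditional on DKKMO's Theorem 1.2.**  Under the named fact
`dkkmo_theorem_1_2_schrammSmirnov` (DKKMO arXiv:2012.11672 Thm. 1.2, `d_SS` half, `q = 1`,
`Ω = ℝ²`), every `μ ∈ subseqQuadLimits univ` is invariant under every rotation of the plane:
`isometryLaw (rotation e^{iα}) μ = μ` for all real `α` — literally the registered signature of
`stub_rotationInvariantLimits`, obtained from the tree theorem
`rotationInput_of_dkkmo_theorem_1_2_schrammSmirnov` (whose conclusion `RotationInput` is this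
statement by `Iff.rfl`). -/
theorem stub_rotationInvariantLimits_of_dkkmo : open Literature.Probability.Percolation.QuadCrossing in Literature.Probability.Percolation.dkkmo_theorem_1_2_schrammSmirnov → ∀ μ ∈ subseqQuadLimits (Set.univ : Set ℂ), ∀ α : ℝ, isometryLaw (rotation (Circle.exp α)).toIsometryEquiv μ = μ :=
  fun hSS =>
    Summit.CriticalPhenomena.CardyFormulaZ2.Theorems.rotationInput_of_dkkmo_theorem_1_2_schrammSmirnov
      hSS

end Summit.CriticalPhenomena.CardyFormulaZ2.Cruxes.Z2LimitsSymmetric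

end
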